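import Summits.Schanuel.Schanuel.Theorems.RootDecomp1KNW96Core02

/-! # RootDecomp1KNW96Core — continuation 03 (the core theorem `core`; lens-6 g23 «NW96 CORE», see part 01 for the full port docstring). -/

noncomputable section
open Finset
namespace Summit.Schanuel.Schanuel.Theorems.RootDecomp1KNW96Core
open Literature.NumberTheory.Transcendental
section Core
open Polynomial NWPi FeldmanDelta NW1996 Waldschmidt1978 Complex Matrix
open scoped Nat

set_option maxHeartbeats 2000000 in
/-- **The core of the simultaneous approximation measure for `(θ, e^θ)`**
([NesterenkoWaldschmidt1996, §6 a)–d)] for GENERAL `θ ∈ ℂ` and algebraic `α ≈ e^θ`, `β ≈ θ`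
(`α, β ≠ 0`, both in a subfield `F ⊂ ℂ` finite over `ℚ`, `[F:ℚ] ≤ Dr`, `[F:ℚ] h(β) ≤ H_β`,
`[F:ℚ] h(α) ≤ H_α`), with Fel'dman's basis `Δ(z; τ, H) e^{θtz}` (`0 ≤ τ ≤ T`, `|t| ≤ T₁`), the
HONEST signed row range `0 ≤ σ ≤ S`, `|s| ≤ S₁` of Lemma 6 as proved (`NWPi.algMatrix_mulVec_eq_zero_pi`),
and ABSTRACT parameters: `H, T, T₁, S, S₁` under condition (2.1), `L = (T+1)(2T₁+1)`,
`m = S₁(T+1)T₁(T₁+1)` (`= ∑_{columns} |t| S₁`, so the Laurent polynomial `R(β, α)` of step c) has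
`deg_α + deg_{α⁻¹} ≤ 2m` — twice the printed `¼LS₁(T₁+½)` per side, the g22 finding), a radius
ratio `E ≥ 1`, `R ≥ max(1, |β|, |θ|)`, `B ≥ max(1, |α|^{±1}, |e^θ|^{±1})`, `lν ≥ log ν(H)`
(`ν(H) = lcm(1,…,H)`), and ONE real `M` dominating both the analytic data (`hMf`: the bound (6.5) for
`|f_{τ,t}^{(σ)}|` on `|z| ≤ ES₁`) and the scaled two-sided perturbation (`hMp`:
`𝔓₀ R^S B^{T₁S₁+1}(S|β − θ| + T₁S₁|α − e^θ|) E^L ≤ e^M`, §6 b)).  Under the MAIN INEQUALITY `hmain`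
— the abstract form of "`(6.5) + (6.6) < ½L(L−1) log E`" with the SHARP Liouville exponent `D − 1`
on the length (`liouville₂_sharp`) and the honest width `2m` on `h(α)` — one gets a contradiction.
Steps: a) a non-singular `L × L` minor `𝒟` of `a(σ,s;τ,t) = ((∂ + tβ)^σ Δ_τ)(s) α^{ts}`;
b) `𝒟 = det(f_{τ,t}^{(σ)}(s) + p)`, `|p| ≤ E^{-L} e^M`, Lemma 3 (`NW1996.norm_det_interpolation_deriv_le`);
c) `α^m ∏ν^{σ_μ} · 𝒟 = ∑ a_l β^{e₁} α^{e₂}`, `e₁ ≤ LS`, `e₂ ≤ 2m`, length `≤ L^L 𝔓^L`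
(`Waldschmidt1978.det_expand`, `NWPi.sum_abs_pZ_le`), and `liouville₂_sharp` in `F`;
d) the two bounds contradict `hmain`.  For `α = −1` (`h(α) = 0`, `F = ℚ(β)`) this is `NWPi.pi_core`
up to bookkeeping; for `h(α) > 0` it is new in the tree. [cite: NesterenkoWaldschmidt1996, §6 a)–d)] -/
theorem core {θ α β : ℂ} (hα0 : α ≠ 0) (hβ0 : β ≠ 0)
    (F : IntermediateField ℚ ℂ) [FiniteDimensional ℚ F] (hβF : β ∈ F) (hαF : α ∈ F)
    {Dr Hβ Hα : ℝ} (hDr : (Module.finrank ℚ F : ℝ) ≤ Dr)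
    (hHβ : (Module.finrank ℚ F : ℝ) * weilHeight₁ F (fun _ : Unit => β) ≤ Hβ)
    (hHα : (Module.finrank ℚ F : ℝ) * weilHeight₁ F (fun _ : Unit => α) ≤ Hα)
    {H T T₁ S S₁ : ℕ} (hH : 1 ≤ H) (hT₁ : 1 ≤ T₁)
    (h2T₁ : 2 * T₁ ≤ S + 1) (hcount : (2 * T₁ + 1) * T < (S + 1 - 2 * T₁) * (2 * S₁ + 1))
    {L m : ℕ} (hL : L = (T + 1) * (2 * T₁ + 1)) (hm : m = S₁ * (T + 1) * (T₁ * (T₁ + 1)))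
    {E R B lν M : ℝ} (hE : 1 ≤ E) (hR : 1 ≤ R) (hβR : ‖β‖ ≤ R) (hθR : ‖θ‖ ≤ R)
    (hB : 1 ≤ B) (hαB : ‖α‖ ≤ B) (hαB' : ‖α‖⁻¹ ≤ B) (hwB : ‖cexp θ‖ ≤ B) (hwB' : ‖cexp θ‖⁻¹ ≤ B)
    (hlν : Real.log (Nat.lcmUpto H) ≤ lν)
    (hMf : (S : ℝ) ^ S * Real.exp ((T : ℝ) + H) * (1 + E * S₁ / H) ^ T * (R * T₁) ^ S *
        Real.exp (‖θ‖ * T₁ * (E * S₁)) ≤ Real.exp M)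
    (hMp : (S : ℝ) ^ S * Real.exp ((T : ℝ) + H) * (1 + (S₁ : ℝ) / H) ^ T * (T₁ : ℝ) ^ S *
        (R ^ S * B ^ (T₁ * S₁ + 1) * ((S : ℝ) * ‖β - θ‖ + ((T₁ * S₁ : ℕ) : ℝ) * ‖α - cexp θ‖)) *
        E ^ L ≤ Real.exp M)
    (hmain : (L : ℝ) * Real.log 2 + Dr * L * Real.log L +
        (Dr - 1) * L * (S * lν + S * Real.log T₁ + S * Real.log S + ((T : ℝ) + H) +
          T * Real.log (1 + (S₁ : ℝ) / H)) +
        L * S * Hβ + 2 * m * Hα + m * Real.log B + L * S * lν + L * M + L * S * Real.log E <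
      (L : ℝ) * ((L : ℝ) - 1) / 2 * Real.log E) :
    False := by
  classical
  /- names and basic facts -/
  set w : ℂ := cexp θ with hw
  have hw0 : w ≠ 0 := Complex.exp_ne_zero θ
  set ν : ℕ := Nat.lcmUpto H with hν
  have hE0 : 0 < E := by linarith
  have hR0 : 0 ≤ R := by linarith
  have hB0 : 0 < B := by linarith
  have hT₁r : (1 : ℝ) ≤ T₁ := by exact_mod_cast hT₁
  have hH0 : (0 : ℝ) < H := by exact_mod_cast hH
  have hν0 : 0 < ν := Nat.lcmUpto_pos H
  have hνr : (1 : ℝ) ≤ ν := by exact_mod_cast hν0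
  have hK1 : (1 : ℝ) ≤ R * T₁ := one_le_mul_of_one_le_of_one_le hR hT₁r
  have hcard : Fintype.card (Fin (T + 1) × Fin (2 * T₁ + 1)) = L := by
    simp [Fintype.card_prod, Fintype.card_fin, hL]
  have hL1 : 1 ≤ L := by rw [hL]; exact Nat.one_le_iff_ne_zero.mpr (by positivity)
  have hLpos : (0 : ℝ) < L := by exact_mod_cast hL1
  have hL1r : (1 : ℝ) ≤ L := by exact_mod_cast hL1
  set ε : ℝ := (E ^ L)⁻¹ with hε
  have hεpos : 0 < ε := by rw [hε]; positivity
  set 𝔐 : ℝ := Real.exp M with h𝔐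
  have h𝔐pos : 0 < 𝔐 := Real.exp_pos M
  have hlog𝔐 : Real.log 𝔐 = M := by rw [h𝔐, Real.log_exp]
  /- a) the matrix and a non-singular minor -/
  set A : Matrix (Fin (S + 1) × Fin (2 * S₁ + 1)) (Fin (T + 1) × Fin (2 * T₁ + 1)) ℂ :=
    Matrix.of fun ω μ =>
      ((twist (((((μ.2 : ℕ) : ℤ) - T₁ : ℤ) : ℂ) * β) ^ (ω.1 : ℕ)) (delta μ.1 H)).eval
          (((((ω.2 : ℕ) : ℤ) - S₁ : ℤ) : ℂ)) *
        α ^ ((((μ.2 : ℕ) : ℤ) - T₁) * ((((ω.2 : ℕ) : ℤ)) - S₁)) with hA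
  have hcols : ∀ c, A *ᵥ c = 0 → c = 0 :=
    fun c hc => algMatrix_mulVec_eq_zero_pi hα0 hβ0 H h2T₁ hcount c hc
  obtain ⟨r, hr⟩ := exists_submatrix_det_ne_zero A hcols
  set σr : Fin (T + 1) × Fin (2 * T₁ + 1) → ℕ := fun i => ((r i).1 : ℕ) with hσr
  set sr : Fin (T + 1) × Fin (2 * T₁ + 1) → ℤ := fun i => (((r i).2 : ℕ) : ℤ) - S₁ with hsr
  set tc : Fin (T + 1) × Fin (2 * T₁ + 1) → ℤ := fun j => (((j.2 : ℕ) : ℤ) - T₁) with htc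
  have hσrS : ∀ i, σr i ≤ S := fun i => Nat.lt_succ_iff.mp (r i).1.isLt
  have hsrS : ∀ i, |sr i| ≤ S₁ := fun i => abs_coord_le S₁ (r i).2
  have htcT : ∀ j, |tc j| ≤ T₁ := fun j => abs_coord_le T₁ j.2
  have hτT : ∀ j : Fin (T + 1) × Fin (2 * T₁ + 1), (j.1 : ℕ) ≤ T := fun j =>
    Nat.lt_succ_iff.mp j.1.isLt
  set Asq : Matrix (Fin (T + 1) × Fin (2 * T₁ + 1)) (Fin (T + 1) × Fin (2 * T₁ + 1)) ℂ :=
    A.submatrix r id with hAsq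
  have hAsq_apply : ∀ i j, Asq i j =
      ((twist ((tc j : ℂ) * β) ^ (σr i)) (delta (j.1 : ℕ) H)).eval (sr i : ℂ) *
        α ^ (tc j * sr i) := by
    intro i j; simp [hAsq, hA, hσr, hsr, htc]
  have hdet : Asq.det ≠ 0 := hr
  /- b) the analytic upper bound -/
  set f : Fin (T + 1) × Fin (2 * T₁ + 1) → ℂ → ℂ :=
    fun j z => (delta (j.1 : ℕ) H).eval z * cexp (θ * (tc j) * z) with hf
  have hf_diff : ∀ j, Differentiable ℂ (f j) := fun j => differentiable_f _ _ _
  set ζ : Fin (T + 1) × Fin (2 * T₁ + 1) → ℂ := fun i => ((sr i : ℤ) : ℂ) with hζ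
  set P : Fin (T + 1) × Fin (2 * T₁ + 1) → Fin (T + 1) × Fin (2 * T₁ + 1) → ℂ :=
    fun i j => Asq i j - iteratedDeriv (σr i) (f j) (ζ i) with hP
  set 𝔓₀ : ℝ := (S : ℝ) ^ S * Real.exp ((T : ℝ) + H) * (1 + (S₁ : ℝ) / H) ^ T * (T₁ : ℝ) ^ S
    with h𝔓₀
  have hSS : (0 : ℝ) < (S : ℝ) ^ S := by
    rcases Nat.eq_zero_or_pos S with h | h
    · subst h; simp
    · exact pow_pos (by exact_mod_cast h) S
  have hζS₁ : ∀ i, ‖ζ i‖ ≤ S₁ := by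
    intro i
    simp only [hζ, Complex.norm_intCast]
    have := hsrS i
    rw [← Int.cast_abs]; exact_mod_cast this
  have hES₁0 : 0 ≤ E * S₁ := by positivity
  have htcr : ∀ j, ‖(tc j : ℂ)‖ ≤ T₁ := by
    intro j
    rw [Complex.norm_intCast, ← Int.cast_abs]; exact_mod_cast htcT j
  have hfM : ∀ i j z, ‖z‖ ≤ E * (S₁ : ℝ) → ‖iteratedDeriv (σr i) (f j) z‖ ≤ 𝔐 := by
    intro i j z hz
    have hcK : ‖θ * (tc j : ℂ)‖ ≤ R * T₁ := by
      rw [norm_mul]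
      exact mul_le_mul hθR (htcr j) (norm_nonneg _) hR0
    have hcK' : ‖θ * (tc j : ℂ)‖ ≤ ‖θ‖ * T₁ := by
      rw [norm_mul]
      exact mul_le_mul_of_nonneg_left (htcr j) (norm_nonneg _)
    have h := norm_iteratedDeriv_f_le' (τ := (j.1 : ℕ)) hH (hσrS i) (hτT j) hK1 hcK
      (by positivity) hcK' hES₁0 hz
    exact h.trans hMf
  -- the perturbation
  have hPM : ∀ i j, ‖P i j‖ ≤ ε * 𝔐 := by
    intro i j
    have h1 : ‖P i j‖ ≤ 𝔓₀ * (R ^ S * B ^ (T₁ * S₁ + 1) *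
        ((S : ℝ) * ‖β - θ‖ + ((T₁ * S₁ : ℕ) : ℝ) * ‖α - cexp θ‖)) := by
      simp only [hP]
      rw [hAsq_apply]
      exact norm_alg_sub_analytic_le' hH (hσrS i) (hτT j) hT₁ (hsrS i) (htcT j) hR hβR hθR hB
        hα0 hαB hαB' hwB hwB'
    have hEL : (0 : ℝ) < E ^ L := by positivity
    have h2 : 𝔓₀ * (R ^ S * B ^ (T₁ * S₁ + 1) *
        ((S : ℝ) * ‖β - θ‖ + ((T₁ * S₁ : ℕ) : ℝ) * ‖α - cexp θ‖)) ≤ 𝔐 * ε := by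
      rw [hε, ← div_eq_mul_inv, le_div_iff₀ hEL]
      exact hMp
    calc ‖P i j‖ ≤ _ := h1
      _ ≤ 𝔐 * ε := h2
      _ = ε * 𝔐 := mul_comm _ _
  have hεE : ε * E ^ Fintype.card (Fin (T + 1) × Fin (2 * T₁ + 1)) ≤ 1 := by
    rw [hcard, hε, inv_mul_cancel₀ (by positivity)]
  have hAsq_eq : Asq = Matrix.of fun i j => iteratedDeriv (σr i) (f j) (ζ i) + P i j := by
    ext i j; simp [hP]
  have hup := norm_det_interpolation_deriv_le f hf_diff σr ζ P hE hζS₁ h𝔐pos.le hεpos.le hεE hfM hPM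
  rw [← hAsq_eq, hcard] at hup
  have hsumσ : ∑ i, σr i ≤ L * S := by
    calc ∑ i, σr i ≤ ∑ _i : Fin (T + 1) × Fin (2 * T₁ + 1), S := Finset.sum_le_sum fun i _ => hσrS i
      _ = L * S := by rw [Finset.sum_const, Finset.card_univ, hcard, smul_eq_mul]
  have hUB : ‖Asq.det‖ * E ^ (∑ x ∈ range L, x) ≤ 2 ^ L * (L : ℝ) ^ L * 𝔐 ^ L * E ^ (L * S) := by
    have h1 : ‖Asq.det‖ ≤ 2 ^ L * (L.factorial : ℝ) * 𝔐 ^ L * E ^ (∑ i, σr i) /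
        E ^ (∑ x ∈ range L, x) := hup
    rw [le_div_iff₀ (by positivity)] at h1
    refine h1.trans ?_
    have h2 : (L.factorial : ℝ) ≤ (L : ℝ) ^ L := by exact_mod_cast Nat.factorial_le_pow L
    have h3 : E ^ (∑ i, σr i) ≤ E ^ (L * S) := pow_le_pow_right₀ hE hsumσ
    gcongr
  /- c) the arithmetic lower bound -/
  set pM : Fin (T + 1) × Fin (2 * T₁ + 1) → Fin (T + 1) × Fin (2 * T₁ + 1) → ℕ → ℤ :=
    fun i j k => pZ H (σr i) (j.1 : ℕ) (sr i) (tc j) k with hpM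
  set dM : Fin (T + 1) × Fin (2 * T₁ + 1) → ℕ → ℕ := fun i k => σr i - k with hdM
  set ex : Fin (T + 1) × Fin (2 * T₁ + 1) → Fin (T + 1) × Fin (2 * T₁ + 1) → ℕ :=
    fun i j => Int.toNat (tc j * sr i + |tc j| * S₁) with hex
  have hex_nonneg : ∀ i j, 0 ≤ tc j * sr i + |tc j| * S₁ := fun i j => shift_nonneg (hsrS i)
  have hex_cast : ∀ i j, ((ex i j : ℕ) : ℤ) = tc j * sr i + |tc j| * S₁ := fun i j =>
    Int.toNat_of_nonneg (hex_nonneg i j)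
  set nsh : Fin (T + 1) × Fin (2 * T₁ + 1) → ℕ := fun j => (tc j).natAbs * S₁ with hnsh
  have hm_eq : ∑ j, nsh j = m := by
    simp only [hnsh, htc]
    rw [← Finset.sum_mul, Fintype.sum_prod_type]
    simp only [Finset.sum_const, Finset.card_univ, Fintype.card_fin, smul_eq_mul]
    rw [sum_natAbs_sub_eq T₁, hm]; ring
  have hpow_ex : ∀ i j, α ^ (ex i j) = α ^ (nsh j) * α ^ (tc j * sr i) := by
    intro i j
    rw [← zpow_natCast, hex_cast, zpow_add₀ hα0, mul_comm, ← zpow_natCast]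
    congr 1
    simp only [hnsh, Nat.cast_mul, Int.natCast_natAbs]
  -- the scaled entries
  have hscaled : ∀ i j, (ν : ℂ) ^ (σr i) * Asq i j =
      (∑ k ∈ range (S + 1), (pM i j k : ℂ) * β ^ dM i k) * α ^ (tc j * sr i) := by
    intro i j
    rw [hAsq_apply, ← mul_assoc, scaled_entry_eq' (j.1 : ℕ) hH (hσrS i) (sr i) (tc j)]
  set N₀ : ℂ := ∏ i, (ν : ℂ) ^ (σr i) with hN₀
  have hN₀ne : N₀ ≠ 0 := by
    rw [hN₀]
    exact Finset.prod_ne_zero_iff.mpr fun i _ => pow_ne_zero _ (by exact_mod_cast hν0.ne')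
  have hN₀norm : ‖N₀‖ ≤ (ν : ℝ) ^ (L * S) := by
    rw [hN₀, norm_prod]
    simp only [norm_pow, Complex.norm_natCast]
    rw [Finset.prod_pow_eq_pow_sum]
    exact pow_le_pow_right₀ hνr hsumσ
  set Ascaled : Matrix (Fin (T + 1) × Fin (2 * T₁ + 1)) (Fin (T + 1) × Fin (2 * T₁ + 1)) ℂ :=
    Matrix.of fun i j => (ν : ℂ) ^ (σr i) * Asq i j with hAscaled
  have hdetAscaled : Ascaled.det = N₀ * Asq.det := by
    rw [hAscaled, Matrix.det_mul_column]
  set M' : Matrix (Fin (T + 1) × Fin (2 * T₁ + 1)) (Fin (T + 1) × Fin (2 * T₁ + 1)) ℂ :=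
    Matrix.of fun i j => (∑ k ∈ range (S + 1), (pM i j k : ℂ) * β ^ dM i k) * α ^ ex i j with hM'
  have hM'_eq : M' = Matrix.of fun i j => α ^ (nsh j) * Ascaled i j := by
    ext i j
    simp only [hM', hAscaled, Matrix.of_apply]
    rw [hscaled, hpow_ex]
    ring
  have hdetM' : M'.det = α ^ m * (N₀ * Asq.det) := by
    rw [hM'_eq, Matrix.det_mul_row, Finset.prod_pow_eq_pow_sum, hm_eq, hdetAscaled]
  have hdetM'ne : M'.det ≠ 0 := by
    rw [hdetM']; exact mul_ne_zero (pow_ne_zero _ hα0) (mul_ne_zero hN₀ne hdet)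
  -- the expansion
  set sIdx := (univ : Finset (Equiv.Perm (Fin (T + 1) × Fin (2 * T₁ + 1)))) ×ˢ
    Fintype.piFinset (fun _ : Fin (T + 1) × Fin (2 * T₁ + 1) => range (S + 1)) with hsIdx
  set aZ : Equiv.Perm (Fin (T + 1) × Fin (2 * T₁ + 1)) × ((Fin (T + 1) × Fin (2 * T₁ + 1)) → ℕ) → ℤ :=
    fun l => ((Equiv.Perm.sign l.1 : ℤˣ) : ℤ) * ∏ j, pM (l.1 j) j (l.2 j) with haZ
  set e₁ : Equiv.Perm (Fin (T + 1) × Fin (2 * T₁ + 1)) × ((Fin (T + 1) × Fin (2 * T₁ + 1)) → ℕ) → ℕ :=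
    fun l => ∑ j, dM (l.1 j) (l.2 j) with he₁
  set e₂ : Equiv.Perm (Fin (T + 1) × Fin (2 * T₁ + 1)) × ((Fin (T + 1) × Fin (2 * T₁ + 1)) → ℕ) → ℕ :=
    fun l => ∑ j, ex (l.1 j) j with he₂
  have hexpand : M'.det = ∑ l ∈ sIdx, (aZ l : ℂ) * β ^ e₁ l * α ^ e₂ l := by
    rw [hM', det_expand]
  have hv : ∑ l ∈ sIdx, (aZ l : ℂ) * β ^ e₁ l * α ^ e₂ l ≠ 0 := by rw [← hexpand]; exact hdetM'ne
  -- degrees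
  have hex_le : ∀ i j, ex i j ≤ 2 * nsh j := by
    intro i j
    have h1 : ((ex i j : ℕ) : ℤ) ≤ 2 * (|tc j| * S₁) := by rw [hex_cast]; exact shift_le (hsrS i)
    have h2 : ((nsh j : ℕ) : ℤ) = |tc j| * S₁ := by
      simp only [hnsh, Nat.cast_mul, Int.natCast_natAbs]
    rw [← h2] at h1
    exact_mod_cast h1
  have hD : ∀ l ∈ sIdx, e₁ l ≤ L * S ∧ e₂ l ≤ 2 * m := by
    intro l _
    constructor
    · calc e₁ l = ∑ j, (σr (l.1 j) - l.2 j) := rfl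
        _ ≤ ∑ _j : Fin (T + 1) × Fin (2 * T₁ + 1), S :=
            Finset.sum_le_sum fun j _ => (Nat.sub_le _ _).trans (hσrS _)
        _ = L * S := by rw [Finset.sum_const, Finset.card_univ, hcard, smul_eq_mul]
    · calc e₂ l = ∑ j, ex (l.1 j) j := rfl
        _ ≤ ∑ j, 2 * nsh j := Finset.sum_le_sum fun j _ => hex_le (l.1 j) j
        _ = 2 * m := by rw [← Finset.mul_sum, hm_eq]
  -- length
  set 𝔓 : ℝ := (ν : ℝ) ^ S * (T₁ : ℝ) ^ S * (S : ℝ) ^ S * Real.exp ((T : ℝ) + H) *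
    (1 + (S₁ : ℝ) / H) ^ T with h𝔓
  have hνS : (0 : ℝ) < (ν : ℝ) ^ S := pow_pos (by positivity) S
  have hT₁S : (0 : ℝ) < (T₁ : ℝ) ^ S := pow_pos (by positivity) S
  have hbT : (0 : ℝ) < (1 + (S₁ : ℝ) / H) ^ T := pow_pos (by positivity) T
  have h𝔓pos : 0 < 𝔓 := by
    rw [h𝔓]
    exact mul_pos (mul_pos (mul_pos (mul_pos hνS hT₁S) hSS) (Real.exp_pos _)) hbT
  have h𝔓1 : 1 ≤ 𝔓 := by
    rw [h𝔓]
    have h1 : (1 : ℝ) ≤ (ν : ℝ) ^ S := one_le_pow₀ hνr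
    have h2 : (1 : ℝ) ≤ (T₁ : ℝ) ^ S := one_le_pow₀ hT₁r
    have h3 : (1 : ℝ) ≤ (S : ℝ) ^ S := by
      rcases Nat.eq_zero_or_pos S with h | h
      · subst h; simp
      · exact one_le_pow₀ (by exact_mod_cast h)
    have h4 : (1 : ℝ) ≤ Real.exp ((T : ℝ) + H) := Real.one_le_exp (by positivity)
    have h5 : (1 : ℝ) ≤ (1 + (S₁ : ℝ) / H) ^ T := one_le_pow₀ (by
      have : (0 : ℝ) ≤ (S₁ : ℝ) / H := by positivity
      linarith)
    calc (1 : ℝ) = 1 * 1 * 1 * 1 * 1 := by ring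
      _ ≤ _ := by gcongr
  have hrow : ∀ i j, ∑ k ∈ range (S + 1), |(pM i j k : ℝ)| ≤ 𝔓 := fun i j =>
    sum_abs_pZ_le hH (hσrS i) (hτT j) hT₁ (hsrS i) (htcT j)
  set Λ : ℝ := (L : ℝ) ^ L * 𝔓 ^ L with hΛ
  have hΛ1 : 1 ≤ Λ := by
    rw [hΛ]
    exact one_le_mul_of_one_le_of_one_le (one_le_pow₀ hL1r) (one_le_pow₀ h𝔓1)
  have hlen : ∑ l ∈ sIdx, |(aZ l : ℝ)| ≤ Λ := by
    have h := sum_abs_detCoeff_le pM S hrow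
    rw [hcard] at h
    refine le_trans (le_of_eq ?_) (h.trans ?_)
    · rfl
    · rw [hΛ]
      have h2 : (L.factorial : ℝ) ≤ (L : ℝ) ^ L := by exact_mod_cast Nat.factorial_le_pow L
      exact mul_le_mul_of_nonneg_right h2 (by positivity)
  have hlog𝔓 : Real.log 𝔓 = S * Real.log ν + S * Real.log T₁ + S * Real.log S + ((T : ℝ) + H) +
      T * Real.log (1 + (S₁ : ℝ) / H) := by
    rw [h𝔓, Real.log_mul (by positivity) hbT.ne', Real.log_mul (by positivity) (Real.exp_pos _).ne',
      Real.log_mul (by positivity) hSS.ne', Real.log_mul hνS.ne' hT₁S.ne', Real.log_pow, Real.log_pow,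
      Real.log_pow, Real.log_pow, Real.log_exp]
  have hlogmax : Real.log (max 1 (∑ l ∈ sIdx, |(aZ l : ℝ)|)) ≤ L * Real.log L + L * Real.log 𝔓 := by
    have h1 : max 1 (∑ l ∈ sIdx, |(aZ l : ℝ)|) ≤ Λ := max_le hΛ1 hlen
    calc Real.log (max 1 (∑ l ∈ sIdx, |(aZ l : ℝ)|)) ≤ Real.log Λ :=
          Real.log_le_log (lt_of_lt_of_le one_pos (le_max_left _ _)) h1
      _ = L * Real.log L + L * Real.log 𝔓 := by
          rw [hΛ, Real.log_mul (by positivity) (by positivity), Real.log_pow, Real.log_pow]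
  have hlogmax0 : 0 ≤ Real.log (max 1 (∑ l ∈ sIdx, |(aZ l : ℝ)|)) := Real.log_nonneg (le_max_left _ _)
  -- Liouville (sharp)
  have hLiou := liouville₂_sharp F hβF hαF sIdx aZ e₁ e₂ hD hv
  have hnormv : ‖∑ l ∈ sIdx, (aZ l : ℂ) * β ^ e₁ l * α ^ e₂ l‖ = ‖α‖ ^ m * (‖N₀‖ * ‖Asq.det‖) := by
    rw [← hexpand, hdetM', norm_mul, norm_mul, norm_pow]
  have hdetpos : 0 < ‖Asq.det‖ := norm_pos_iff.mpr hdet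
  have hαpos : 0 < ‖α‖ := norm_pos_iff.mpr hα0
  have hN₀pos : 0 < ‖N₀‖ := norm_pos_iff.mpr hN₀ne
  have hV : -(((Module.finrank ℚ F : ℝ) - 1) * Real.log (max 1 (∑ l ∈ sIdx, |(aZ l : ℝ)|)) +
        (Module.finrank ℚ F : ℝ) * (((L * S : ℕ) : ℝ) * weilHeight₁ F (fun _ : Unit => β) +
          ((2 * m : ℕ) : ℝ) * weilHeight₁ F (fun _ : Unit => α))) ≤
      (m : ℝ) * Real.log ‖α‖ + (Real.log ‖N₀‖ + Real.log ‖Asq.det‖) := by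
    have h := hLiou
    rwa [hnormv, Real.log_mul (by positivity) (by positivity), Real.log_pow,
      Real.log_mul (by positivity) (by positivity)] at h
  /- d) the contradiction -/
  -- the analytic side in logarithms
  have hsumL : ((∑ x ∈ range L, x : ℕ) : ℝ) = (L : ℝ) * (L - 1) / 2 := by
    have h := Finset.sum_range_id_mul_two L
    have h' : ((∑ x ∈ range L, x : ℕ) : ℝ) * 2 = (L : ℝ) * ((L - 1 : ℕ) : ℝ) := by exact_mod_cast h
    rw [Nat.cast_sub hL1, Nat.cast_one] at h'
    linarith only [h']
  have hLSr : ((L * S : ℕ) : ℝ) = (L : ℝ) * S := by push_cast; ring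
  have h2mr : ((2 * m : ℕ) : ℝ) = 2 * (m : ℝ) := by push_cast; ring
  have hU : Real.log ‖Asq.det‖ + (L : ℝ) * ((L : ℝ) - 1) / 2 * Real.log E ≤
      L * Real.log 2 + L * Real.log L + L * M + L * S * Real.log E := by
    have h := Real.log_le_log (mul_pos hdetpos (pow_pos hE0 _)) hUB
    rw [Real.log_mul hdetpos.ne' (pow_pos hE0 _).ne', Real.log_pow, hsumL,
      Real.log_mul (by positivity) (by positivity), Real.log_mul (by positivity) (by positivity),
      Real.log_mul (by positivity) (by positivity), Real.log_pow, Real.log_pow, Real.log_pow,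
      Real.log_pow, hlog𝔐, hLSr] at h
    linarith only [h]
  -- the elementary comparisons
  have hfin1 : (1 : ℝ) ≤ Module.finrank ℚ F := by exact_mod_cast Module.finrank_pos
  have hD0 : (0 : ℝ) ≤ (Module.finrank ℚ F : ℝ) - 1 := by linarith
  have hDr1 : (Module.finrank ℚ F : ℝ) - 1 ≤ Dr - 1 := by linarith
  have hDr0 : 0 ≤ Dr - 1 := hD0.trans hDr1
  have hlogL0 : 0 ≤ Real.log (L : ℝ) := Real.log_nonneg hL1r
  have hlogν0 : 0 ≤ Real.log (ν : ℝ) := Real.log_nonneg hνr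
  have hlogT₁0 : 0 ≤ Real.log (T₁ : ℝ) := Real.log_nonneg hT₁r
  have hSlogS0 : 0 ≤ (S : ℝ) * Real.log S := by
    rcases Nat.eq_zero_or_pos S with h | h
    · subst h; simp
    · exact mul_nonneg (Nat.cast_nonneg _) (Real.log_nonneg (by exact_mod_cast h))
  have hlogb0 : 0 ≤ Real.log (1 + (S₁ : ℝ) / H) := Real.log_nonneg (by
    have : (0 : ℝ) ≤ (S₁ : ℝ) / H := by positivity
    linarith)
  have hS0 : (0 : ℝ) ≤ S := Nat.cast_nonneg _
  have hT0 : (0 : ℝ) ≤ T := Nat.cast_nonneg _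
  have hL0 : (0 : ℝ) ≤ L := Nat.cast_nonneg _
  have hm0 : (0 : ℝ) ≤ m := Nat.cast_nonneg _
  -- `log 𝔓 ≤ S lν + …`
  have hlog𝔓le : Real.log 𝔓 ≤ S * lν + S * Real.log T₁ + S * Real.log S + ((T : ℝ) + H) +
      T * Real.log (1 + (S₁ : ℝ) / H) := by
    rw [hlog𝔓]
    have := mul_le_mul_of_nonneg_left hlν hS0
    linarith only [this]
  -- f1: `m log |α| ≤ m log B`
  have f1 : (m : ℝ) * Real.log ‖α‖ ≤ m * Real.log B :=
    mul_le_mul_of_nonneg_left (Real.log_le_log hαpos hαB) hm0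
  -- f2: `log |N₀| ≤ L S lν`
  have f2 : Real.log ‖N₀‖ ≤ (L : ℝ) * S * lν := by
    have h1 : Real.log ‖N₀‖ ≤ Real.log ((ν : ℝ) ^ (L * S)) := Real.log_le_log hN₀pos hN₀norm
    rw [Real.log_pow, hLSr] at h1
    have h2 : (L : ℝ) * S * Real.log ν ≤ (L : ℝ) * S * lν :=
      mul_le_mul_of_nonneg_left hlν (by positivity)
    linarith only [h1, h2]
  -- f3: `(D-1) log max ≤ (Dr-1) (L log L + L (S lν + …))`
  have f3 : ((Module.finrank ℚ F : ℝ) - 1) * Real.log (max 1 (∑ l ∈ sIdx, |(aZ l : ℝ)|)) ≤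
      (Dr - 1) * ((L : ℝ) * Real.log L + L * (S * lν + S * Real.log T₁ + S * Real.log S +
        ((T : ℝ) + H) + T * Real.log (1 + (S₁ : ℝ) / H))) := by
    have h1 : Real.log (max 1 (∑ l ∈ sIdx, |(aZ l : ℝ)|)) ≤
        (L : ℝ) * Real.log L + L * (S * lν + S * Real.log T₁ + S * Real.log S +
          ((T : ℝ) + H) + T * Real.log (1 + (S₁ : ℝ) / H)) := by
      have := mul_le_mul_of_nonneg_left hlog𝔓le hL0
      linarith only [hlogmax, this]
    exact mul_le_mul hDr1 h1 hlogmax0 hDr0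
  -- f4, f5: the heights
  have f4 : (Module.finrank ℚ F : ℝ) * (((L * S : ℕ) : ℝ) * weilHeight₁ F (fun _ : Unit => β)) ≤
      (L : ℝ) * S * Hβ := by
    rw [hLSr]
    calc (Module.finrank ℚ F : ℝ) * ((L : ℝ) * S * weilHeight₁ F (fun _ : Unit => β))
        = (L : ℝ) * S * ((Module.finrank ℚ F : ℝ) * weilHeight₁ F (fun _ : Unit => β)) := by ring
      _ ≤ (L : ℝ) * S * Hβ := mul_le_mul_of_nonneg_left hHβ (by positivity)
  have f5 : (Module.finrank ℚ F : ℝ) * (((2 * m : ℕ) : ℝ) * weilHeight₁ F (fun _ : Unit => α)) ≤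
      2 * (m : ℝ) * Hα := by
    rw [h2mr]
    calc (Module.finrank ℚ F : ℝ) * (2 * (m : ℝ) * weilHeight₁ F (fun _ : Unit => α))
        = 2 * (m : ℝ) * ((Module.finrank ℚ F : ℝ) * weilHeight₁ F (fun _ : Unit => α)) := by ring
      _ ≤ 2 * (m : ℝ) * Hα := mul_le_mul_of_nonneg_left hHα (by positivity)
  -- combine
  have key : (L : ℝ) * ((L : ℝ) - 1) / 2 * Real.log E ≤
      (L : ℝ) * Real.log 2 + Dr * L * Real.log L +
        (Dr - 1) * L * (S * lν + S * Real.log T₁ + S * Real.log S + ((T : ℝ) + H) +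
          T * Real.log (1 + (S₁ : ℝ) / H)) +
        L * S * Hβ + 2 * m * Hα + m * Real.log B + L * S * lν + L * M + L * S * Real.log E := by
    linarith [hU, hV, f1, f2, f3, f4, f5]
  exact absurd key (not_le.mpr hmain)

end Core

end Summit.Schanuel.Schanuel.Theorems.RootDecomp1KNW96Core
end
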